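/-
Copyright (c) 2026 the pub-hodgecm-mathlib formalisation cell (harness21).  Prover seat hodgecm-mathlib-F0P2-p01 (g15): road «S3-ram» (LEAD F0P3a-plan (g12); architect
A-p16 (g31); junction pen F0P3a-p01 (g17), J-PACK v2 03ef5f1f; owner F0P3a-p06 (g15)), organ A′ (ii): FILE M, the label side of ROW-E ∕ ROW-O («the only neighbour whose line
lies in the kernel of the residual matrix is the inward one»); 2026-09-02.
-/
import Literature.NumberTheory.Automorphic.UnitaryLatticeTreeFixedGrandchildFrameRamified   -- ★ L p847469 (this seat); brings ★ K, J, I, H, G′, G, F, E, D, ★ G3, ★ `UnitaryLatticeTreeFixedStar`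
import HarnessLib

/-!
# The lattice graph of a hermitian space — THE KERNEL LINE OF A RESIDUALLY NILPOTENT FIXED VERTEX (tame-ramified place): in the inward-adapted frame the residual matrix
# is `γ′(E₁₂ − E₀₁)` (even depth) or `γ′(E₀₁ + E₁₂) + s·E₀₂` (odd depth), so its kernel is the inward line (Bruhat–Tits 1972 §10; Tits 1979 §3.5; Kottwitz 1986 §3)

Topic `NumberTheory/Automorphic`; namespace `Literature.NumberTheory.Automorphic.UnitaryLatticeTree`.  THEOREMS ONLY (no definition, no instance, no notation, no named fact,
no `sorry`); kernel lane `--supports stmt-HodgeConjecture-24833`.  Cell `pub/hodgecm-mathlib` (D-0151), crux H413; road «S3-ram» (Literature seeding, count-neutral), organ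
A′ (ii) of the P-1-ram skeleton (architect A-p16 (g31)); junction J-PACK v2 (F0P3a-p01 (g17)) rows ROW-E ∕ ROW-O, LABEL side: their conclusion «every OUTWARD grandchild
through a null line has rank 2» rests, via ★ J `not_lev_and_not_lev₂_childLatt_of_cube_le`, on «the outward line is NOT in `ker Ȳ`», i.e. on **`ker Ȳ` = the INWARD line**.
J₀-MODEL; `γ ∈ U(σ,J₀)` (the element seen from the vertex, `(uκ₀)⁻¹γ(uκ₀)` in the unitary frame `uκ₀` ADAPTED TO THE INWARD LINE `ē₀`), `Y := γ − 1` of level `ϖ^d`, `d ≥ 1`;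
the orientation hypothesis `hup` of the sheet («the parent is at least as deep») enters only through its consequence ★ J §1–§2: the inward line is a kernel line,
`|Y_{i0}| ≤ |ϖ|^{d+1}` (`hcol`).  DATUM `hvσ hσϖ hϖ hres h2`.

THE MATHEMATICS.  EVEN `d`: ★ I's antisymmetry + the zero first column leave `Ȳ = γ′·(E₁₂ − E₀₁)` (§1), exact depth forces `γ′ ≠ 0`.  ODD `d`: ★ K's symmetry + the zero
column leave `Ȳ = !![0,γ′,s; 0,β′,γ′; 0,0,0]`, residual nilpotency (`Y³` of level `ϖ^{3d+1}`) kills `β′` (`(Ȳ³)₁₁ = β′³`), rank two (`Y²` not of level `ϖ^{2d+1}`) is `γ′ ≠ 0` (§2).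
Either way the KERNEL TEST (§3) `Yy ≡ 0 ⇒ ȳ ∈ ⟨ē₀⟩` holds, and for `k ∈ K₀` the first column of `k⁻¹Yk` vanishes residually iff `|k₂₀| < 1` iff `k·N₁ = N₁` (★ K): the only
neighbour whose line is a kernel line is the INWARD one, so ★ J `not_lev_and_not_lev₂_childLatt_of_cube_le` fires at every OUTWARD null line (rows `E → q²·O`, `O → q·E`).

* §1 **`forall_v_coe_sub_one_le_succ_of_even_of_col`**, `v_coe_sub_one_zero_one_add_one_two_le_of_even`, **`v_coe_sub_one_one_two_eq_of_even_of_col`**.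
* §2 `v_le_succ_of_cube_le`, **`v_coe_sub_one_one_one_le_of_odd_of_col_of_cube`**, `forall_v_coe_sub_one_le_succ_of_odd_of_col`, **`v_coe_sub_one_one_two_eq_of_odd_of_col_of_sq`**.
* (§3 = the sequel file `UnitaryLatticeTreeNilpotentVertexKernelTestRamified`: the kernel test and the frame change `↔ |k₂₀| < 1`.)

HONEST LABEL: HC_CM is proved only modulo the 2 remaining named inputs (hLiu418 24832, h413 24833) until rung 0 closes; nothing printed is asserted here (elementary algebra
over a valuation ring); «S3-ram» has no books consequence.

## References
* [BruhatTits1972] F. Bruhat, J. Tits, *Groupes réductifs sur un corps local I*, Publ. Math. IHÉS 41 (1972), §10 (lattice models; vertex stabilisers and their filtrations).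
* [Tits1979] J. Tits, *Reductive groups over local fields*, PSPM 33.1 (1979), §3.5 (congruence filtration; reduction mod `𝔭`).
* [Kottwitz1986] R. E. Kottwitz, *Base change for unit elements of Hecke algebras*, Compositio Math. 60 (1986), §3 (levels of fixed lattices; shell recursion).
* [Serre1980Trees] J.-P. Serre, *Trees* (1980), Ch. II §1.1 (neighbours of a lattice = lines of its reduction).
-/

set_option autoImplicit false

noncomputable section

open scoped Valued WithZero Matrix MatrixGroups

namespace Literature.NumberTheory.Automorphic.UnitaryLatticeTree

open Literature.NumberTheory.Automorphic Literature.NumberTheory.Automorphic.HermitianLattice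

variable {K : Type*} [Field K] [Valued K ℤᵐ⁰] {σ : K →+* K} {ϖ : K}

/-! ## §1 Even depth: `Ȳ = γ′·(E₁₂ − E₀₁)` -/

/-- **EVEN SHAPE**: `γ ∈ U(σ,J₀)`, `Y = γ − 1` of level `ϖ^d`, `d` even, `d ≥ 1`, first column `≡ 0 (ϖ^{d+1})` (inward line in the kernel): every entry off `{(0,1), (1,2)}` is
`≤ |ϖ|^{d+1}`. [cite: Tits1979, §3.5] [cite: Kottwitz1986, §3] -/
theorem forall_v_coe_sub_one_le_succ_of_even_of_col (hvσ : ∀ z, Valued.v (σ z) = Valued.v z) (hσϖ : σ ϖ = -ϖ) (hϖ : Valued.v ϖ = WithZero.exp (-1 : ℤ))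
    (hres : ∀ x : K, Valued.v x ≤ 1 → Valued.v (σ x - x) < 1) (h2 : Valued.v (2 : K) = 1)
    (γ : unitaryGroupOfForm σ ((StdForm.antidiagonal 3).over K)) {d : ℕ} (hd : Even d) (hd1 : 1 ≤ d)
    (hY : ∀ i j, Valued.v ((((γ : GL (Fin 3) K) : Matrix (Fin 3) (Fin 3) K) - 1) i j) ≤ Valued.v ϖ ^ d)
    (hcol : ∀ i, Valued.v ((((γ : GL (Fin 3) K) : Matrix (Fin 3) (Fin 3) K) - 1) i 0) ≤ Valued.v ϖ ^ (d + 1))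
    {i j : Fin 3} (hij : ¬ (i = 0 ∧ j = 1)) (hij' : ¬ (i = 1 ∧ j = 2)) :
    Valued.v ((((γ : GL (Fin 3) K) : Matrix (Fin 3) (Fin 3) K) - 1) i j) ≤ Valued.v ϖ ^ (d + 1) := by
  have hanti := v_coe_sub_one_apply_add_rev_le_of_even hvσ hσϖ hϖ hres γ hd hd1 hY
  have hdiag := v_coe_sub_one_rev_apply_le_of_even hvσ hσϖ hϖ hres h2 γ hd hd1 hY
  set Y : Matrix (Fin 3) (Fin 3) K := ((γ : GL (Fin 3) K) : Matrix (Fin 3) (Fin 3) K) - 1 with hYdef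
  have hr0 : (0 : Fin 3).rev = 2 := rfl
  have hr1 : (1 : Fin 3).rev = 1 := rfl
  have hr2 : (2 : Fin 3).rev = 0 := rfl
  have h00 : Valued.v (Y 0 0) ≤ Valued.v ϖ ^ (d + 1) := hcol 0
  have h10 : Valued.v (Y 1 0) ≤ Valued.v ϖ ^ (d + 1) := hcol 1
  have h20 : Valued.v (Y 2 0) ≤ Valued.v ϖ ^ (d + 1) := hcol 2
  have h11 : Valued.v (Y 1 1) ≤ Valued.v ϖ ^ (d + 1) := by have h := hdiag 1; rw [hr1] at h; exact h
  have h02 : Valued.v (Y 0 2) ≤ Valued.v ϖ ^ (d + 1) := by have h := hdiag 2; rw [hr2] at h; exact h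
  have h22 : Valued.v (Y 2 2) ≤ Valued.v ϖ ^ (d + 1) := by
    have h := hanti 2 2; rw [hr2] at h
    have e : Y 2 2 = (Y 2 2 + Y 0 0) - Y 0 0 := by ring
    rw [e]; exact (Valuation.map_sub _ _ _).trans (max_le h h00)
  have h21 : Valued.v (Y 2 1) ≤ Valued.v ϖ ^ (d + 1) := by
    have h := hanti 2 1; rw [hr1, hr2] at h
    have e : Y 2 1 = (Y 2 1 + Y 1 0) - Y 1 0 := by ring
    rw [e]; exact (Valuation.map_sub _ _ _).trans (max_le h h10)
  fin_cases i <;> fin_cases j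
  · exact h00
  · exact absurd ⟨rfl, rfl⟩ hij
  · exact h02
  · exact h10
  · exact h11
  · exact absurd ⟨rfl, rfl⟩ hij'
  · exact h20
  · exact h21
  · exact h22

/-- **Even shape, the antisymmetric pair**: `|Y₀₁ + Y₁₂| ≤ |ϖ|^{d+1}` (★ I at `(0,1)`). [cite: Tits1979, §3.5] -/
theorem v_coe_sub_one_zero_one_add_one_two_le_of_even (hvσ : ∀ z, Valued.v (σ z) = Valued.v z) (hσϖ : σ ϖ = -ϖ) (hϖ : Valued.v ϖ = WithZero.exp (-1 : ℤ))
    (hres : ∀ x : K, Valued.v x ≤ 1 → Valued.v (σ x - x) < 1)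
    (γ : unitaryGroupOfForm σ ((StdForm.antidiagonal 3).over K)) {d : ℕ} (hd : Even d) (hd1 : 1 ≤ d)
    (hY : ∀ i j, Valued.v ((((γ : GL (Fin 3) K) : Matrix (Fin 3) (Fin 3) K) - 1) i j) ≤ Valued.v ϖ ^ d) :
    Valued.v ((((γ : GL (Fin 3) K) : Matrix (Fin 3) (Fin 3) K) - 1) 0 1 + (((γ : GL (Fin 3) K) : Matrix (Fin 3) (Fin 3) K) - 1) 1 2) ≤ Valued.v ϖ ^ (d + 1) := by
  have h := v_coe_sub_one_apply_add_rev_le_of_even hvσ hσϖ hϖ hres γ hd hd1 hY 0 1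
  have hr0 : (0 : Fin 3).rev = 2 := rfl
  have hr1 : (1 : Fin 3).rev = 1 := rfl
  rw [hr0, hr1] at h
  exact h

/-- **Even shape, exact depth**: if moreover `Y` is NOT of level `ϖ^{d+1}` then `|Y₁₂| = |ϖ|^d` (and `|Y₀₁| = |ϖ|^d`): the residual matrix is `γ′(E₁₂ − E₀₁)`, `γ′ ≠ 0` — rank 2
for free. [cite: Tits1979, §3.5] [cite: Kottwitz1986, §3] -/
theorem v_coe_sub_one_one_two_eq_of_even_of_col (hvσ : ∀ z, Valued.v (σ z) = Valued.v z) (hσϖ : σ ϖ = -ϖ) (hϖ : Valued.v ϖ = WithZero.exp (-1 : ℤ))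
    (hres : ∀ x : K, Valued.v x ≤ 1 → Valued.v (σ x - x) < 1) (h2 : Valued.v (2 : K) = 1)
    (γ : unitaryGroupOfForm σ ((StdForm.antidiagonal 3).over K)) {d : ℕ} (hd : Even d) (hd1 : 1 ≤ d)
    (hY : ∀ i j, Valued.v ((((γ : GL (Fin 3) K) : Matrix (Fin 3) (Fin 3) K) - 1) i j) ≤ Valued.v ϖ ^ d)
    (hcol : ∀ i, Valued.v ((((γ : GL (Fin 3) K) : Matrix (Fin 3) (Fin 3) K) - 1) i 0) ≤ Valued.v ϖ ^ (d + 1))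
    (hexact : ¬ ∀ i j, Valued.v ((((γ : GL (Fin 3) K) : Matrix (Fin 3) (Fin 3) K) - 1) i j) ≤ Valued.v ϖ ^ (d + 1)) :
    Valued.v ((((γ : GL (Fin 3) K) : Matrix (Fin 3) (Fin 3) K) - 1) 1 2) = Valued.v ϖ ^ d ∧
      Valued.v ((((γ : GL (Fin 3) K) : Matrix (Fin 3) (Fin 3) K) - 1) 0 1) = Valued.v ϖ ^ d := by
  have hshape := fun i j => forall_v_coe_sub_one_le_succ_of_even_of_col hvσ hσϖ hϖ hres h2 γ hd hd1 hY hcol (i := i) (j := j)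
  have hpair := v_coe_sub_one_zero_one_add_one_two_le_of_even hvσ hσϖ hϖ hres γ hd hd1 hY
  set Y : Matrix (Fin 3) (Fin 3) K := ((γ : GL (Fin 3) K) : Matrix (Fin 3) (Fin 3) K) - 1 with hYdef
  have hϖ0 : ϖ ≠ 0 := fun h0 => by rw [h0, map_zero] at hϖ; exact WithZero.coe_ne_zero hϖ.symm
  have hvϖ0 : Valued.v ϖ ≠ 0 := (Valuation.ne_zero_iff _).2 hϖ0
  have hϖlt : Valued.v ϖ < 1 := by rw [hϖ, ← WithZero.exp_zero]; exact WithZero.exp_lt_exp.2 (by norm_num)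
  have hlt : Valued.v ϖ ^ (d + 1) < Valued.v ϖ ^ d := by
    rw [pow_succ]; exact mul_lt_of_lt_one_right (zero_lt_iff.2 (pow_ne_zero _ hvϖ0)) hϖlt
  have hdm : Valued.v ϖ ^ d = Valued.v ϖ ^ (d + 1) * WithZero.exp (1 : ℤ) := by
    rw [pow_succ, hϖ, mul_assoc, ← WithZero.exp_add]; norm_num
  -- discreteness: `≠ |ϖ|^d` with `≤ |ϖ|^d` means `≤ |ϖ|^(d+1)`
  have hstep : ∀ {x : K}, Valued.v x ≤ Valued.v ϖ ^ d → ¬ Valued.v x = Valued.v ϖ ^ d → Valued.v x ≤ Valued.v ϖ ^ (d + 1) := fun {x} hx hne => by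
    have h' : Valued.v x < Valued.v ϖ ^ d := lt_of_le_of_ne hx hne
    rw [hdm] at h'
    exact (WithZero.lt_mul_exp_iff_le (pow_ne_zero _ hvϖ0)).1 h'
  -- the two pivots agree: `|Y₀₁| = |ϖ|^d ↔ |Y₁₂| = |ϖ|^d`
  have h12_of_01 : Valued.v (Y 0 1) = Valued.v ϖ ^ d → Valued.v (Y 1 2) = Valued.v ϖ ^ d := fun h01 => by
    have e : Y 1 2 = (Y 0 1 + Y 1 2) - Y 0 1 := by ring
    have hl : Valued.v (Y 0 1 + Y 1 2) < Valued.v (Y 0 1) := (hpair.trans_lt hlt).trans_eq h01.symm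
    rw [e, Valuation.map_sub_eq_of_lt_right _ hl, h01]
  have h12 : Valued.v (Y 1 2) = Valued.v ϖ ^ d := by
    by_contra hne
    have h12' := hstep (hY 1 2) hne
    have h01' : Valued.v (Y 0 1) ≤ Valued.v ϖ ^ (d + 1) := by
      by_contra hne'
      exact hne (h12_of_01 (by
        by_contra h01ne
        exact hne' (hstep (hY 0 1) h01ne)))
    apply hexact
    intro i j
    by_cases hij : i = 0 ∧ j = 1
    · obtain ⟨rfl, rfl⟩ := hij; exact h01'
    by_cases hij' : i = 1 ∧ j = 2
    · obtain ⟨rfl, rfl⟩ := hij'; exact h12'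
    exact hshape i j hij hij'
  refine ⟨h12, ?_⟩
  have e : Y 0 1 = (Y 0 1 + Y 1 2) - Y 1 2 := by ring
  have hl : Valued.v (Y 0 1 + Y 1 2) < Valued.v (Y 1 2) := (hpair.trans_lt hlt).trans_eq h12.symm
  rw [e, Valuation.map_sub_eq_of_lt_right _ hl, h12]

/-! ## §2 Odd depth: `Ȳ = γ′(E₀₁ + E₁₂) + s·E₀₂` -/

/-- Discreteness for cubes: `|y| ≤ |ϖ|^d`, `|y³| ≤ |ϖ|^{3d+1}` ⇒ `|y| ≤ |ϖ|^{d+1}`. [cite: Serre1980Trees, II.1.1] -/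
theorem v_le_succ_of_cube_le (hϖ : Valued.v ϖ = WithZero.exp (-1 : ℤ)) {d : ℕ} {y : K} (hy : Valued.v y ≤ Valued.v ϖ ^ d)
    (hcube : Valued.v (y * y * y) ≤ Valued.v ϖ ^ (3 * d + 1)) : Valued.v y ≤ Valued.v ϖ ^ (d + 1) := by
  have hϖ0 : ϖ ≠ 0 := fun h0 => by rw [h0, map_zero] at hϖ; exact WithZero.coe_ne_zero hϖ.symm
  have hvϖ0 : Valued.v ϖ ≠ 0 := (Valuation.ne_zero_iff _).2 hϖ0
  have hϖlt : Valued.v ϖ < 1 := by rw [hϖ, ← WithZero.exp_zero]; exact WithZero.exp_lt_exp.2 (by norm_num)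
  by_contra hne
  have hge : Valued.v ϖ ^ d ≤ Valued.v y := by
    by_contra hlt
    rw [not_le] at hlt
    have hdm : Valued.v ϖ ^ d = Valued.v ϖ ^ (d + 1) * WithZero.exp (1 : ℤ) := by
      rw [pow_succ, hϖ, mul_assoc, ← WithZero.exp_add]; norm_num
    rw [hdm] at hlt
    exact hne ((WithZero.lt_mul_exp_iff_le (pow_ne_zero _ hvϖ0)).1 hlt)
  have heq : Valued.v y = Valued.v ϖ ^ d := le_antisymm hy hge
  have h3d : Valued.v ϖ ^ (3 * d + 1) < Valued.v ϖ ^ d * Valued.v ϖ ^ d * Valued.v ϖ ^ d := by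
    rw [← pow_add, ← pow_add, show d + d + d = 3 * d by ring, pow_succ]
    exact mul_lt_of_lt_one_right (zero_lt_iff.2 (pow_ne_zero _ hvϖ0)) hϖlt
  rw [map_mul, map_mul, heq] at hcube
  exact (lt_irrefl _) (hcube.trans_lt h3d)

/-- **ODD SHAPE, the middle entry**: `γ ∈ U(σ,J₀)`, `Y = γ − 1` of level `ϖ^d` (`d` odd), first column `≡ 0`, and `Y³` of level `ϖ^{3d+1}` (residual nilpotency): `|Y₁₁| ≤ |ϖ|^{d+1}`
(`(Ȳ³)₁₁ = ȳ₁₁³` once the column and `Y₂₁ ≡ Y₁₀`, `Y₂₂ ≡ Y₀₀` vanish). [cite: Tits1979, §3.5] [cite: Kottwitz1986, §3] -/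
theorem v_coe_sub_one_one_one_le_of_odd_of_col_of_cube (hvσ : ∀ z, Valued.v (σ z) = Valued.v z) (hσϖ : σ ϖ = -ϖ) (hϖ : Valued.v ϖ = WithZero.exp (-1 : ℤ))
    (hres : ∀ x : K, Valued.v x ≤ 1 → Valued.v (σ x - x) < 1)
    (γ : unitaryGroupOfForm σ ((StdForm.antidiagonal 3).over K)) {d : ℕ} (hd : Odd d)
    (hY : ∀ i j, Valued.v ((((γ : GL (Fin 3) K) : Matrix (Fin 3) (Fin 3) K) - 1) i j) ≤ Valued.v ϖ ^ d)
    (hcol : ∀ i, Valued.v ((((γ : GL (Fin 3) K) : Matrix (Fin 3) (Fin 3) K) - 1) i 0) ≤ Valued.v ϖ ^ (d + 1))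
    (hcube : ∀ i j, Valued.v (((((γ : GL (Fin 3) K) : Matrix (Fin 3) (Fin 3) K) - 1) * ((((γ : GL (Fin 3) K) : Matrix (Fin 3) (Fin 3) K) - 1)) *
      ((((γ : GL (Fin 3) K) : Matrix (Fin 3) (Fin 3) K) - 1))) i j) ≤ Valued.v ϖ ^ (3 * d + 1)) :
    Valued.v ((((γ : GL (Fin 3) K) : Matrix (Fin 3) (Fin 3) K) - 1) 1 1) ≤ Valued.v ϖ ^ (d + 1) := by
  have hsym := v_coe_sub_one_apply_sub_rev_le_of_odd hvσ hσϖ hϖ hres γ hd hY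
  set Y : Matrix (Fin 3) (Fin 3) K := ((γ : GL (Fin 3) K) : Matrix (Fin 3) (Fin 3) K) - 1 with hYdef
  have hr0 : (0 : Fin 3).rev = 2 := rfl
  have hr1 : (1 : Fin 3).rev = 1 := rfl
  have hr2 : (2 : Fin 3).rev = 0 := rfl
  have h10 : Valued.v (Y 1 0) ≤ Valued.v ϖ ^ (d + 1) := hcol 1
  have h20 : Valued.v (Y 2 0) ≤ Valued.v ϖ ^ (d + 1) := hcol 2
  have h21 : Valued.v (Y 2 1) ≤ Valued.v ϖ ^ (d + 1) := by
    have h := hsym 2 1; rw [hr1, hr2] at h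
    have e : Y 2 1 = (Y 2 1 - Y 1 0) + Y 1 0 := by ring
    rw [e]; exact (Valuation.map_add _ _ _).trans (max_le h h10)
  -- a triple product with ONE factor `≤ |ϖ|^(d+1)` is `≤ |ϖ|^(3d+1)`
  have hsum : Valued.v ϖ ^ (3 * d + 1) = Valued.v ϖ ^ d * Valued.v ϖ ^ d * Valued.v ϖ ^ (d + 1) := by rw [← pow_add, ← pow_add]; congr 1; omega
  have h3 : ∀ {x y z : K}, Valued.v x ≤ Valued.v ϖ ^ d → Valued.v y ≤ Valued.v ϖ ^ d → Valued.v z ≤ Valued.v ϖ ^ (d + 1) →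
      Valued.v (x * y * z) ≤ Valued.v ϖ ^ (3 * d + 1) ∧ Valued.v (x * z * y) ≤ Valued.v ϖ ^ (3 * d + 1) ∧ Valued.v (z * x * y) ≤ Valued.v ϖ ^ (3 * d + 1) := by
    intro x y z hx hy hz
    refine ⟨by rw [map_mul, map_mul, hsum]; exact mul_le_mul' (mul_le_mul' hx hy) hz, ?_, ?_⟩
    · rw [show x * z * y = x * y * z by ring, map_mul, map_mul, hsum]; exact mul_le_mul' (mul_le_mul' hx hy) hz
    · rw [show z * x * y = x * y * z by ring, map_mul, map_mul, hsum]; exact mul_le_mul' (mul_le_mul' hx hy) hz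
  refine v_le_succ_of_cube_le hϖ (hY 1 1) ?_
  -- `(Y³)₁₁ = Σ_{a,b} Y₁ₐ Y_{ab} Y_{b1}`; every term but `Y₁₁³` carries `Y₁₀`, `Y₂₀`, `Y₂₁` (or `Y_{a0}`)
  have h111 := hcube 1 1
  have e : (Y * Y * Y) 1 1 = Y 1 1 * Y 1 1 * Y 1 1 +
      (Y 1 0 * Y 0 0 * Y 0 1 + Y 1 0 * Y 0 1 * Y 1 1 + Y 1 0 * Y 0 2 * Y 2 1 +
       Y 1 1 * Y 1 0 * Y 0 1 + Y 1 1 * Y 1 2 * Y 2 1 +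
       Y 1 2 * Y 2 0 * Y 0 1 + Y 1 2 * Y 2 1 * Y 1 1 + Y 1 2 * Y 2 2 * Y 2 1) := by
    simp only [Matrix.mul_apply, Fin.sum_univ_three]; ring
  have hrest : Valued.v (Y 1 0 * Y 0 0 * Y 0 1 + Y 1 0 * Y 0 1 * Y 1 1 + Y 1 0 * Y 0 2 * Y 2 1 +
       Y 1 1 * Y 1 0 * Y 0 1 + Y 1 1 * Y 1 2 * Y 2 1 +
       Y 1 2 * Y 2 0 * Y 0 1 + Y 1 2 * Y 2 1 * Y 1 1 + Y 1 2 * Y 2 2 * Y 2 1) ≤ Valued.v ϖ ^ (3 * d + 1) := by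
    refine (Valuation.map_add _ _ _).trans (max_le ((Valuation.map_add _ _ _).trans (max_le ((Valuation.map_add _ _ _).trans (max_le
      ((Valuation.map_add _ _ _).trans (max_le ((Valuation.map_add _ _ _).trans (max_le ((Valuation.map_add _ _ _).trans (max_le
      ((Valuation.map_add _ _ _).trans (max_le ?_ ?_)) ?_)) ?_)) ?_)) ?_)) ?_)) ?_)
    · exact (h3 (hY 0 0) (hY 0 1) h10).2.2
    · exact (h3 (hY 0 1) (hY 1 1) h10).2.2
    · exact (h3 (hY 0 2) (hY 2 1) h10).2.2
    · exact (h3 (hY 1 1) (hY 0 1) h10).2.1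
    · exact (h3 (hY 1 1) (hY 1 2) h21).1
    · exact (h3 (hY 1 2) (hY 0 1) h20).2.1
    · exact (h3 (hY 1 2) (hY 1 1) h21).2.1
    · exact (h3 (hY 1 2) (hY 2 2) h21).1
  have e' : Y 1 1 * Y 1 1 * Y 1 1 = (Y * Y * Y) 1 1 - (Y 1 0 * Y 0 0 * Y 0 1 + Y 1 0 * Y 0 1 * Y 1 1 + Y 1 0 * Y 0 2 * Y 2 1 +
       Y 1 1 * Y 1 0 * Y 0 1 + Y 1 1 * Y 1 2 * Y 2 1 +
       Y 1 2 * Y 2 0 * Y 0 1 + Y 1 2 * Y 2 1 * Y 1 1 + Y 1 2 * Y 2 2 * Y 2 1) := by rw [e]; ring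
  rw [e']
  exact (Valuation.map_sub _ _ _).trans (max_le h111 hrest)

/-- **ODD SHAPE**: with `|Y₁₁| ≤ |ϖ|^{d+1}` in hand (previous lemma), the zero column and ★ K's symmetry: every entry off `{(0,1), (1,2), (0,2)}` is `≤ |ϖ|^{d+1}` and
`|Y₀₁ − Y₁₂| ≤ |ϖ|^{d+1}` — `Ȳ = γ′(E₀₁ + E₁₂) + s·E₀₂`. [cite: Tits1979, §3.5] [cite: Kottwitz1986, §3] -/
theorem forall_v_coe_sub_one_le_succ_of_odd_of_col (hvσ : ∀ z, Valued.v (σ z) = Valued.v z) (hσϖ : σ ϖ = -ϖ) (hϖ : Valued.v ϖ = WithZero.exp (-1 : ℤ))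
    (hres : ∀ x : K, Valued.v x ≤ 1 → Valued.v (σ x - x) < 1)
    (γ : unitaryGroupOfForm σ ((StdForm.antidiagonal 3).over K)) {d : ℕ} (hd : Odd d)
    (hY : ∀ i j, Valued.v ((((γ : GL (Fin 3) K) : Matrix (Fin 3) (Fin 3) K) - 1) i j) ≤ Valued.v ϖ ^ d)
    (hcol : ∀ i, Valued.v ((((γ : GL (Fin 3) K) : Matrix (Fin 3) (Fin 3) K) - 1) i 0) ≤ Valued.v ϖ ^ (d + 1))
    (hcube : ∀ i j, Valued.v (((((γ : GL (Fin 3) K) : Matrix (Fin 3) (Fin 3) K) - 1) * ((((γ : GL (Fin 3) K) : Matrix (Fin 3) (Fin 3) K) - 1)) *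
      ((((γ : GL (Fin 3) K) : Matrix (Fin 3) (Fin 3) K) - 1))) i j) ≤ Valued.v ϖ ^ (3 * d + 1)) :
    (∀ i j : Fin 3, ¬ (i = 0 ∧ j = 1) → ¬ (i = 1 ∧ j = 2) → ¬ (i = 0 ∧ j = 2) → Valued.v ((((γ : GL (Fin 3) K) : Matrix (Fin 3) (Fin 3) K) - 1) i j) ≤ Valued.v ϖ ^ (d + 1)) ∧
      Valued.v ((((γ : GL (Fin 3) K) : Matrix (Fin 3) (Fin 3) K) - 1) 0 1 - (((γ : GL (Fin 3) K) : Matrix (Fin 3) (Fin 3) K) - 1) 1 2) ≤ Valued.v ϖ ^ (d + 1) := by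
  have hsym := v_coe_sub_one_apply_sub_rev_le_of_odd hvσ hσϖ hϖ hres γ hd hY
  have h11 := v_coe_sub_one_one_one_le_of_odd_of_col_of_cube hvσ hσϖ hϖ hres γ hd hY hcol hcube
  set Y : Matrix (Fin 3) (Fin 3) K := ((γ : GL (Fin 3) K) : Matrix (Fin 3) (Fin 3) K) - 1 with hYdef
  have hr0 : (0 : Fin 3).rev = 2 := rfl
  have hr1 : (1 : Fin 3).rev = 1 := rfl
  have hr2 : (2 : Fin 3).rev = 0 := rfl
  have h00 : Valued.v (Y 0 0) ≤ Valued.v ϖ ^ (d + 1) := hcol 0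
  have h10 : Valued.v (Y 1 0) ≤ Valued.v ϖ ^ (d + 1) := hcol 1
  have h20 : Valued.v (Y 2 0) ≤ Valued.v ϖ ^ (d + 1) := hcol 2
  have h22 : Valued.v (Y 2 2) ≤ Valued.v ϖ ^ (d + 1) := by
    have h := hsym 2 2; rw [hr2] at h
    have e : Y 2 2 = (Y 2 2 - Y 0 0) + Y 0 0 := by ring
    rw [e]; exact (Valuation.map_add _ _ _).trans (max_le h h00)
  have h21 : Valued.v (Y 2 1) ≤ Valued.v ϖ ^ (d + 1) := by
    have h := hsym 2 1; rw [hr1, hr2] at h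
    have e : Y 2 1 = (Y 2 1 - Y 1 0) + Y 1 0 := by ring
    rw [e]; exact (Valuation.map_add _ _ _).trans (max_le h h10)
  refine ⟨fun i j hij hij' hij'' => ?_, by have h := hsym 0 1; rw [hr1, hr0] at h; exact h⟩
  fin_cases i <;> fin_cases j
  · exact h00
  · exact absurd ⟨rfl, rfl⟩ hij
  · exact absurd ⟨rfl, rfl⟩ hij''
  · exact h10
  · exact h11
  · exact absurd ⟨rfl, rfl⟩ hij'
  · exact h20
  · exact h21
  · exact h22

/-- **ODD SHAPE, rank two means `|Y₁₂| = |ϖ|^d`**: if moreover `Y²` is NOT of level `ϖ^{2d+1}` (token `¬LEV₂(ϖ^{2d+1})`: rank 2) then `|Y₁₂| = |Y₀₁| = |ϖ|^d`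
(`Ȳ² = γ′²·E₀₂`). [cite: Tits1979, §3.5] [cite: Kottwitz1986, §3] -/
theorem v_coe_sub_one_one_two_eq_of_odd_of_col_of_sq (hvσ : ∀ z, Valued.v (σ z) = Valued.v z) (hσϖ : σ ϖ = -ϖ) (hϖ : Valued.v ϖ = WithZero.exp (-1 : ℤ))
    (hres : ∀ x : K, Valued.v x ≤ 1 → Valued.v (σ x - x) < 1)
    (γ : unitaryGroupOfForm σ ((StdForm.antidiagonal 3).over K)) {d : ℕ} (hd : Odd d)
    (hY : ∀ i j, Valued.v ((((γ : GL (Fin 3) K) : Matrix (Fin 3) (Fin 3) K) - 1) i j) ≤ Valued.v ϖ ^ d)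
    (hcol : ∀ i, Valued.v ((((γ : GL (Fin 3) K) : Matrix (Fin 3) (Fin 3) K) - 1) i 0) ≤ Valued.v ϖ ^ (d + 1))
    (hcube : ∀ i j, Valued.v (((((γ : GL (Fin 3) K) : Matrix (Fin 3) (Fin 3) K) - 1) * ((((γ : GL (Fin 3) K) : Matrix (Fin 3) (Fin 3) K) - 1)) *
      ((((γ : GL (Fin 3) K) : Matrix (Fin 3) (Fin 3) K) - 1))) i j) ≤ Valued.v ϖ ^ (3 * d + 1))
    (hrank : ¬ ∀ i j, Valued.v (((((γ : GL (Fin 3) K) : Matrix (Fin 3) (Fin 3) K) - 1) * ((((γ : GL (Fin 3) K) : Matrix (Fin 3) (Fin 3) K) - 1))) i j) ≤ Valued.v ϖ ^ (2 * d + 1)) :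
    Valued.v ((((γ : GL (Fin 3) K) : Matrix (Fin 3) (Fin 3) K) - 1) 1 2) = Valued.v ϖ ^ d ∧
      Valued.v ((((γ : GL (Fin 3) K) : Matrix (Fin 3) (Fin 3) K) - 1) 0 1) = Valued.v ϖ ^ d := by
  obtain ⟨hshape, hpair⟩ := forall_v_coe_sub_one_le_succ_of_odd_of_col hvσ hσϖ hϖ hres γ hd hY hcol hcube
  set Y : Matrix (Fin 3) (Fin 3) K := ((γ : GL (Fin 3) K) : Matrix (Fin 3) (Fin 3) K) - 1 with hYdef
  have hϖ0 : ϖ ≠ 0 := fun h0 => by rw [h0, map_zero] at hϖ; exact WithZero.coe_ne_zero hϖ.symm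
  have hvϖ0 : Valued.v ϖ ≠ 0 := (Valuation.ne_zero_iff _).2 hϖ0
  have hϖlt : Valued.v ϖ < 1 := by rw [hϖ, ← WithZero.exp_zero]; exact WithZero.exp_lt_exp.2 (by norm_num)
  have hlt : Valued.v ϖ ^ (d + 1) < Valued.v ϖ ^ d := by
    rw [pow_succ]; exact mul_lt_of_lt_one_right (zero_lt_iff.2 (pow_ne_zero _ hvϖ0)) hϖlt
  have hdm : Valued.v ϖ ^ d = Valued.v ϖ ^ (d + 1) * WithZero.exp (1 : ℤ) := by
    rw [pow_succ, hϖ, mul_assoc, ← WithZero.exp_add]; norm_num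
  have hstep : ∀ {x : K}, Valued.v x ≤ Valued.v ϖ ^ d → ¬ Valued.v x = Valued.v ϖ ^ d → Valued.v x ≤ Valued.v ϖ ^ (d + 1) := fun {x} hx hne => by
    have h' : Valued.v x < Valued.v ϖ ^ d := lt_of_le_of_ne hx hne
    rw [hdm] at h'
    exact (WithZero.lt_mul_exp_iff_le (pow_ne_zero _ hvϖ0)).1 h'
  -- symmetric pivots: `|Y₀₁| = |ϖ|^d ↔ |Y₁₂| = |ϖ|^d`
  have h01_of_12 : Valued.v (Y 1 2) = Valued.v ϖ ^ d → Valued.v (Y 0 1) = Valued.v ϖ ^ d := fun h12 => by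
    have e : Y 0 1 = (Y 0 1 - Y 1 2) + Y 1 2 := by ring
    have hl : Valued.v (Y 0 1 - Y 1 2) < Valued.v (Y 1 2) := (hpair.trans_lt hlt).trans_eq h12.symm
    rw [e, Valuation.map_add_eq_of_lt_right _ hl, h12]
  have h12_of_01 : Valued.v (Y 0 1) = Valued.v ϖ ^ d → Valued.v (Y 1 2) = Valued.v ϖ ^ d := fun h01 => by
    have e : Y 1 2 = Y 0 1 - (Y 0 1 - Y 1 2) := by ring
    have hl : Valued.v (Y 0 1 - Y 1 2) < Valued.v (Y 0 1) := (hpair.trans_lt hlt).trans_eq h01.symm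
    rw [e, Valuation.map_sub_eq_of_lt_left _ hl, h01]
  have h12 : Valued.v (Y 1 2) = Valued.v ϖ ^ d := by
    by_contra hne
    have h12' := hstep (hY 1 2) hne
    have h01' : Valued.v (Y 0 1) ≤ Valued.v ϖ ^ (d + 1) := by
      by_contra hne'
      refine hne (h12_of_01 ?_)
      by_contra h01ne
      exact hne' (hstep (hY 0 1) h01ne)
    -- then every entry but `Y₀₂` is small, and `Y²` has level `ϖ^(2d+1)`: contradiction with rank two
    have hsmall : ∀ i j : Fin 3, ¬ (i = 0 ∧ j = 2) → Valued.v (Y i j) ≤ Valued.v ϖ ^ (d + 1) := by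
      intro i j hij
      by_cases h1 : i = 0 ∧ j = 1
      · obtain ⟨rfl, rfl⟩ := h1; exact h01'
      by_cases h2' : i = 1 ∧ j = 2
      · obtain ⟨rfl, rfl⟩ := h2'; exact h12'
      exact hshape i j h1 h2' hij
    have hϖ1 : Valued.v ϖ ≤ 1 := hϖlt.le
    apply hrank
    intro i j
    have hsum : Valued.v ϖ ^ (2 * d + 1) = Valued.v ϖ ^ (d + 1) * Valued.v ϖ ^ d := by rw [← pow_add]; congr 1; omega
    rw [hsum]
    -- ★ H `v_mul_self_apply_le_of_corner_le` with the large entry at `(0,2)`: reindex by the corner at `(0,2)` — direct three-term bound instead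
    rw [Matrix.mul_apply]
    refine Valuation.map_sum_le _ fun k _ => ?_
    rw [map_mul]
    by_cases hik : i = 0 ∧ k = 2
    · obtain ⟨rfl, rfl⟩ := hik
      -- `Y₀₂ · Y₂ⱼ`: the second factor is in the zero ROW 2 (`Y₂₀, Y₂₁, Y₂₂` small)
      have h2j : Valued.v (Y 2 j) ≤ Valued.v ϖ ^ (d + 1) := hsmall 2 j (by simp)
      rw [mul_comm]; exact mul_le_mul' h2j (hY 0 2)
    · exact mul_le_mul' (hsmall i k hik) (hY k j)
  exact ⟨h12, h01_of_12 h12⟩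

end Literature.NumberTheory.Automorphic.UnitaryLatticeTree

end
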